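import Summits.BirchSwinnertonDyer.BirchSwinnertonDyer.Theses.ThetaPartnerAtTwo
import Summits.BirchSwinnertonDyer.BirchSwinnertonDyer.Theses.ResidualThetaTransportAtTwo
import Summits.BirchSwinnertonDyer.BirchSwinnertonDyer.Theorems.ThetaPartnerAtTwoSignedControlAtTwoCasselsOfPT
import Summits.BirchSwinnertonDyer.BirchSwinnertonDyer.Theorems.ThetaPartnerAtTwoSignedControlAtTwoCoinvOfResTwo
import Summits.BirchSwinnertonDyer.BirchSwinnertonDyer.Theorems.ThetaPartnerAtTwoSignedControlAtTwoShaTwoPrimaryVanishing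
import HarnessLib

/-!
# K4 `SignedControlAtTwo` BY NAME from FOUR generic Poitou–Tate facts over `ℚ` — the door of the Prop-4.12 elimination lane

Route `ThetaPartnerAtTwo` (TP2; crux shared with `ResidualThetaTransportAtTwo`), crux K4 `SignedControlAtTwo`
(stmt-BirchSwinnertonDyer-20309), line `eulerchar` v11 (sha16 50a2041f5216dbea). Seat `prover-bsd-wall-tp2-p3-w2` (width seat 2/3, gen 5).

**Both route copies of the crux decl, CONDITIONALLY on four named class-field-theoretic facts and nothing else:**
`poitouTate_selmerStructure_duality ℚ` (Milne I Thm. 4.10 (b) for Selmer structures — feeds CASSELS through width seat w3's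
`SignedEC.CasselsPT.casselsSurjectivity_H1Sigma_of_poitouTate`), `poitouTate_sha_tateDual ℚ` (Thm. 4.10 (a): `Ш²(ℚ, E[2^∞])` FINITE,
part 4a), `poitouTate_three_realPlaces_injective ℚ` and `poitouTate_two_realPlaces_surjective ℚ` (Thm. 4.10 (c) for `r = 3` and
Cor. 4.16: `Ш²(ℚ, E[2^∞])` `2`-DIVISIBLE, part 4b).  The composition is the registered v11 composition with its second stub
`stub_shaTwoPrimaryVanishing` replaced by the conditional closer `SignedEC.ShaTwo.stub_shaTwoPrimaryVanishing_of_poitouTate`: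
conjunct (i) `SignedSelmerDualData.moduleFinite`; conjunct (ii) `kimControl_at_of_signedEulerCharTwo` ∘
`SignedEC.ResTwo.signedEulerChar_two_of_cassels_of_resTwo` with `hres` from `SignedEC.ResTwo.resTwo_injective_of_shaTwo` (inside the
`Finite Sel_{2^∞}` binder).  NO Greenberg (1999) print (Prop. 4.12, Prop. 4.13, corank count), NO Kato, NO weak Leopoldt remain: the
registered residue of K4 becomes generic Poitou–Tate duality over `ℚ` (outputs of the class-formation road).

* `signedControl_body_of_poitouTate_four` — both conjuncts of the crux body for every curve of the row;
* `signedControlAtTwo_of_poitouTate_four`, `signedControlAtTwo_rtt_of_poitouTate_four` — the two route copies BY NAME.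
HONEST FRAMING: THEOREMS ONLY (no definition, no named fact, no `sorry`); a `conditional-result` on four cited named facts taken as
hypotheses; closes no item by itself (the item closes when the facts are discharged or re-registered as stubs); BSD is not proved.

References: [MilneADT2006] I Thm. 4.10 (a)–(c), Cor. 4.16, Thm. 6.13 (c); [GreenbergLNM1716] §4 Props. 4.12–4.13, pp. 119–122;
[BDKim2013] Cor. 3.15; [Kobayashi2003] Thm. 1.2.
-/

set_option autoImplicit false
-- the Theorems namespace of this sub repeats the summit name by design (D-0017 nested layout)
set_option linter.dupNamespace false

noncomputable section

open Literature.NumberTheory.EllipticCurves Literature.NumberTheory.GaloisRepresentations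
open Literature.NumberTheory.GaloisRepresentations.DiscreteGaloisModule (shaTwo)
open Literature.NumberTheory.GaloisCohomology

namespace Summit.BirchSwinnertonDyer.BirchSwinnertonDyer.Theorems.SignedEC.Door

/-- **Both conjuncts of the crux body of K4 for EVERY curve of the row** (`GoodSS W 2`, `a₂ = 0`), from the four generic
Poitou–Tate facts over `ℚ` (hypotheses, by name): CASSELS from PT(b) (w3), COINV⁺@2/EC2 from CASSELS and `hres` (part 2), `hres`
from `Ш²(ℚ, E[2^∞]) = 0` (part 3), which holds on the row from PT(a) and the two archimedean rows (parts 4a–4b).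
[cite: MilneADT2006, Ch. I, Thm. 4.10 (a),(b),(c), Cor. 4.16] [cite: BDKim2013, Cor. 3.15] [cite: GreenbergLNM1716, §4 pp. 119–122] -/
theorem signedControl_body_of_poitouTate_four (hPTb : poitouTate_selmerStructure_duality ℚ)
    (hPTa : poitouTate_sha_tateDual ℚ) (h3 : poitouTate_three_realPlaces_injective ℚ)
    (h2 : poitouTate_two_realPlaces_surjective ℚ) (W : WeierstrassCurve ℚ) [W.IsElliptic] [W.IsGloballyMinimal]
    (hss : Rank1Residual.GoodSS W 2) (ha : W.frobeniusTrace 2 = 0) :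
    (∀ (κ : ZpExtension ℚ 2) (γ : Field.absoluteGaloisGroup ℚ), κ.IsCyclotomic → κ.IsTopGenerator γ →
        ∀ D : Kobayashi2003.SignedSelmerDualData W κ γ 1, Module.Finite (IwasawaAlgebra 2) D.X) ∧
      (∀ (κ : ZpExtension ℚ 2) (γ : Field.absoluteGaloisGroup ℚ), κ.IsCyclotomic → κ.IsTopGenerator γ →
        ∀ (D : Kobayashi2003.SignedSelmerDualData W κ γ 1) [Module.Finite (IwasawaAlgebra 2) D.X],
          Module.IsTorsion (IwasawaAlgebra 2) D.X → ∀ g : IwasawaAlgebra 2, D.charIdeal = Ideal.span {g} →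
          Finite (W.selmerGroupPInfty 2) →
          ∃ u : ℤ_[2]ˣ, ((PowerSeries.constantCoeff g : ℤ_[2]) : ℚ_[2]) =
            ((u : ℤ_[2]) : ℚ_[2]) * ((2 : ℕ) : ℚ_[2]) ^ (padicValNat 2 W.tamagawaProduct) *
              (Nat.card (W.selmerGroupPInfty 2) : ℚ_[2])) := by
  have hC : Greenberg1999.casselsSurjectivity_H1Sigma ℚ := CasselsPT.casselsSurjectivity_H1Sigma_of_poitouTate hPTb
  refine ⟨fun _ _ _ hγ D ↦ Kobayashi2003.SignedSelmerDualData.moduleFinite hγ D, ?_⟩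
  exact kimControl_at_of_signedEulerCharTwo fun κ _ hκ hγ hSel ↦
    ResTwo.signedEulerChar_two_of_cassels_of_resTwo W κ hss ha hκ hγ hC
      (fun c hc ↦ ResTwo.resTwo_injective_of_shaTwo W κ hss
        (ShaTwo.stub_shaTwoPrimaryVanishing_of_poitouTate hPTa h3 h2 W hss ha hSel) c hc)
      hSel

/-- **K4 `SignedControlAtTwo` (route `ThetaPartnerAtTwo` copy) BY NAME from the four generic Poitou–Tate facts over `ℚ`** — the
binders `¬ W.HasCM`, `W.analyticRank = 0` of the crux are idle. A `conditional-result`; nothing else of print remains.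
[cite: MilneADT2006, Ch. I, Thm. 4.10 (a),(b),(c), Cor. 4.16] [cite: Kobayashi2003, Thm. 1.2] [cite: BDKim2013, Cor. 3.15] -/
theorem signedControlAtTwo_of_poitouTate_four (hPTb : poitouTate_selmerStructure_duality ℚ)
    (hPTa : poitouTate_sha_tateDual ℚ) (h3 : poitouTate_three_realPlaces_injective ℚ)
    (h2 : poitouTate_two_realPlaces_surjective ℚ) :
    Summit.BirchSwinnertonDyer.BirchSwinnertonDyer.Theses.ThetaPartnerAtTwo.SignedControlAtTwo := by
  intro W _ _ _ _ hss ha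
  exact signedControl_body_of_poitouTate_four hPTb hPTa h3 h2 W hss ha

/-- **K4 `SignedControlAtTwo` (route `ResidualThetaTransportAtTwo` copy) BY NAME from the same four facts** (identical body; the
crux item is shared by both routes). [cite: MilneADT2006, Ch. I, Thm. 4.10 (a),(b),(c), Cor. 4.16] [cite: Kobayashi2003, Thm. 1.2] -/
theorem signedControlAtTwo_rtt_of_poitouTate_four (hPTb : poitouTate_selmerStructure_duality ℚ)
    (hPTa : poitouTate_sha_tateDual ℚ) (h3 : poitouTate_three_realPlaces_injective ℚ)
    (h2 : poitouTate_two_realPlaces_surjective ℚ) :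
    Summit.BirchSwinnertonDyer.BirchSwinnertonDyer.Theses.ResidualThetaTransportAtTwo.SignedControlAtTwo := by
  intro W _ _ _ _ hss ha
  exact signedControl_body_of_poitouTate_four hPTb hPTa h3 h2 W hss ha

end Summit.BirchSwinnertonDyer.BirchSwinnertonDyer.Theorems.SignedEC.Door

end
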